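import Mathlib
import HarnessLib
import Summits.HubbardSuperconductivity.HubbardSuperconductivity.Theses.KLProgramme
import Summits.HubbardSuperconductivity.HubbardSuperconductivity.Theorems.KLProgrammeKLRegimeCountertermV12Body

/-!
# Route `KLProgramme` — crux `KLRegimeCountertermV12` (stmt-HubbardSuperconductivity-19857; gen-4 K3 resplit on `klPredsV12`, Δ21, route rev 15) — CLOSED

The COUNTERTERM child `CountertermP2 klPredsV12 klWindowC` of crux K3 `KLRegimeTwoPointLimit` at the gen-4 bundle: ONE admissible frame `K`,
chosen before the volume, renormalised (`RenormalisedAtF`, quadratic tolerance) at every scale and every large volume.  Its body is the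
`EngineBoundsAtV8S` instance `KLRegimeSplit.CtE.countertermP2_klPredsV12` (`…CountertermV12Body`) of the ENGINE-SLOT-GENERIC counterterm chain
(`…SplitTwoLegStepE` → `…CountertermBlockE` → `…CountertermContinuationE` → `…CountertermOneVolumeMsE`; mathematics of the one-volume wholesale
continuation: k3c3-p2, reading k3c3-p1 / k3c3-p3 / p1b, thresholds p2, volume transfer + generic packaging k3c5-p1), which type-checks against the
route declaration because `klPredsV12 = klPredsE EngineBoundsAtV8S` definitionally (`klPredsV12_eq_klPredsE`, `rfl`).  No stubs.
-/

namespace Summit.HubbardSuperconductivity.HubbardSuperconductivity.Theorems.KLRegimeCounterterm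

/-- **Crux `KLRegimeCountertermV12` holds**: the gen-4 counterterm child `CountertermP2 klPredsV12 klWindowC`, by the engine-slot-generic
counterterm chain instantiated at `EngineBoundsAtV8S`. -/
theorem KLRegimeCountertermV12_of :
    Summit.HubbardSuperconductivity.HubbardSuperconductivity.Theses.KLProgramme.KLRegimeCountertermV12 :=
  KLRegimeSplit.CtE.countertermP2_klPredsV12

end Summit.HubbardSuperconductivity.HubbardSuperconductivity.Theorems.KLRegimeCounterterm
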